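import Literature.MathematicalPhysics.QuantumFieldTheory.Balaban1983to89.B9RWSums346Two
import Literature.MathematicalPhysics.QuantumFieldTheory.Balaban1983to89.B9RWSums344InputGp

/-!
# `Balaban1983to89.B9RWSums346TwoGp` — [B9] the two-sided L² line ‖h∇_UG′(U)∇\*_Uλ‖ of (3.46) for the random walk sum (3.90) G′(U)
# PROVED inside the leaf of Theorem 3.7 at the all-blocks pin — the G′ twin of `B9RWSums346Two`: the leaf of Theorem 3.1 for the sum
# with NO displayed residual

T. Bałaban, *Propagators for lattice gauge theories in a background field*, Commun. Math. Phys. **99** (1985) 389–434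
[`Balaban1985BackgroundPropagators`, "B9"]; [4] = T. Bałaban, *Propagators and renormalization transformations for lattice
gauge theories. II*, Commun. Math. Phys. **96** (1984) 223–250 [`Balaban1984PropagatorsII`].

statement-level skeleton of published theorems with citation tags; proofs where landed; nothing here is a claim about the
Yang–Mills mass gap

THE PRINTED LOCI (verbatim).  (3.46), p. 398: *"Finally, we have the inequalities in L²-norms ‖hG′(U)λ‖, ‖h∇_UG′(U)λ‖, ‖hG′(U)∇\*_Uλ‖,
‖hΔ_UG′(U)λ‖, … ≦ B₀[(L^jη)², L^jη, L^jη, 1, 1, 1]|h|e^{−δ₀d(y,y′)}‖λ‖"*; Theorem 3.7 p. 409: *"G′ = G′₀(I − R′)⁻¹ … The expansion is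
convergent in all norms appearing in the inequalities (3.42)–(3.47)"*; p. 410: *"Theorem 3.7 implies that all the inequalities
(3.42)–(3.47) hold for G′, thus we have completed the proof of Theorem 3.1."*

THE POINT.  `B9RWSums346Two` removes the last displayed member of the G-sum's leaf.  THIS FILE does the same for the G′-sum of (3.90)
at n06-c's letters `B9Thm37Whole.Ops` ∕ the pin `E37AllOfOps`: ∇_UG′∇\*_U = ∇_UG′₀∇\*_U + (∇_UG′)(R′∇\*_U) (G′ = G′₀ + G′R′, (3.88)); L² head
legs (`L2TwoLegs37`, POSITED), the sibling's L² bound of ∇_UG′ (`B9RWSums346Schur.blockBd_entry1`), the L² bounds of the terms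
K(h_□)G′_□h_□∇\*_U of R′∇\*_U with (L^jη)⁻¹ (`FactorsL2_37`, POSITED), `B9RWSums346Two.tail_comp_l2`; `l2line4_of_local37`; ★
`thm37Printed_allPin_complete` — the leaf `B9.Thm37Printed c35 geo bg (fun i => E37AllOfOps …)` from `h37` (n06-c's sup-block leaf) and
operator-level hypothesis schemas ONLY: no displayed residual.

HONEST SCOPE.  Nothing of print is asserted; every input is a hypothesis of printed shape about the local operators G′_□(U), the terms
of R′, the structure (3.88), the readings and letters; NOT a node discharge, NOT summit progress; one finite lattice paper; nothing
continuum, nothing about the mass gap.  Cell `pub-ymgap` (HUMAN RULING D-0062), Track A node N06 [B9], seat `pub-ymgap-dag-n06-k`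
(rows 18–19, successor gen), 2026-08-27.
-/

namespace Literature.MathematicalPhysics.QuantumFieldTheory.Balaban1983to89.B9RWSums346TwoGp

open Literature.MathematicalPhysics.QuantumFieldTheory.Balaban1983to89
open Finset B6RandomWalk B6RandomWalkHom B9Thm37Sum B9Thm34Ext B9Thm37Glue B9Thm37Whole B9Cor38Whole
open B9RWSums343to347Whole B9RWSums346Schur B9Thm37GlueCor36 B9RWSums343Holder B9RWSums343HolderGp B9RWSums346Lap
open B9RWSums344Input B9RWSums344InputGp B9RWSums346Two B11SectG B9Thm37AllNorms B9SectDL2Decay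

noncomputable section

/-! ## §1 The sum G′(U) of (3.90) at one member and one U -/

section GpSide

variable {g : B9.Geometry} [Fintype g.Site] [DecidableEq g.Site] {R : ℝ} {H : Prop} {B : B9.Backgrounds}
variable {X Y ι : Type}

/-- **COROLLARY 3.6's TWO-SIDED L² LINE OF (3.46) FOR THE HEAD TERMS h_□G′_□(U)h_□ OF (3.90), LOCALIZED** (the G′ twin of
`L2TwoLegs310`).  POSITED AS A WHOLE; a HYPOTHESIS SCHEMA, Corollary 3.6 is not asserted.
[cite: Balaban1985BackgroundPropagators, Cor. 3.6 p.408 + (3.87) p.409 + (3.46) p.398 + (3.100) p.413] -/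
structure L2TwoLegs37 [Fintype Y] (𝔬 : Ops g B X Y ι) (R : ℝ) (H : Prop) (S2 : ι → Finset g.Site) (B2 δ₀ : ℝ) (U : B.Cfg) :
    Prop where
  l4 : ∀ i, BlockBd (g := toB6 g R H) 𝔬.blkY 𝔬.blkY (𝔬.D U ∘ₗ ((mulOp (𝔬.h i) * 𝔬.Gsq U i * mulOp (𝔬.h i)) ∘ₗ 𝔬.Dstar U))
    (fun (a b : g.Site) => (if a ∈ S2 i then (1 : ℝ) else 0) * (B2 * Real.exp (-(δ₀ * g.dist a b))))

/-- **THE TERMS K(h_□)G′_□(U)h_□∇\*_U OF R′∇\*_U IN THE BLOCK-L² NORMS** ((3.88)–(3.89) p. 409 read against ∇\*_U with the power (L^jη)⁻¹;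
p. 398's convention): ‖1_{Δ(y)}(P_□∇_U + C_□)G′_□h_□∇\*_Uμ‖₂ ≦ 1_{S′_□}(y)·θ₂·(L^jη)⁻¹·e^{−δ₀d(y,y′)}‖μ‖₂, supp μ ⊂ Δ(y′).  POSITED; a
HYPOTHESIS SCHEMA. [cite: Balaban1985BackgroundPropagators, (3.88)–(3.89) p.409 + (3.46) p.398; Balaban1984PropagatorsII, (2.40)–(2.44) p.230] -/
structure FactorsL2_37 [Fintype X] [Fintype Y] (𝔬 : Ops g B X Y ι) (R : ℝ) (H : Prop) (θ2 δ₀ : ℝ) (U : B.Cfg) : Prop where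
  facD : ∀ i : ι, BlockBd (g := toB6 g R H) 𝔬.blkY 𝔬.blk (((𝔬.P U i ∘ₗ 𝔬.D U + 𝔬.Cop U i) * 𝔬.Gsq U i * mulOp (𝔬.h i)) ∘ₗ 𝔬.Dstar U)
    (fun (y y' : g.Site) => (if y ∈ 𝔬.S' i then (1 : ℝ) else 0) * (θ2 * (g.len y)⁻¹ * Real.exp (-(δ₀ * g.dist y y'))))

omit [Fintype g.Site] [DecidableEq g.Site] in
/-- Algebra of (3.88) read through ∇_U on the left and ∇\*_U on the right. [folklore] -/
private theorem twoSided_split₃ {Z Y' : Type} {E : (X → ℝ) →ₗ[ℝ] (Z → ℝ)} {Dst : (Y' → ℝ) →ₗ[ℝ] (X → ℝ)}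
    {G G0 W : Module.End ℝ (X → ℝ)} (h : G = G0 + G * W) :
    E ∘ₗ (G ∘ₗ Dst) = E ∘ₗ (G0 ∘ₗ Dst) + (E ∘ₗ G) ∘ₗ (W ∘ₗ Dst) := by
  conv_lhs => rw [h]
  apply LinearMap.ext
  intro μ
  simp only [LinearMap.comp_apply, LinearMap.add_apply, Module.End.mul_apply, map_add]

omit [DecidableEq g.Site] in
/-- L² block bounds add (the `l2w` dictionary). [folklore] -/
private theorem blockBd_add' [Fintype X] {Z : Type} [Fintype Z] (blk₁ : X → g.Site) (blk₂ : Z → g.Site)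
    {T₁ T₂ : (X → ℝ) →ₗ[ℝ] (Z → ℝ)} {K₁ K₂ : g.Site → g.Site → ℝ} (h₁ : BlockBd (g := toB6 g R H) blk₁ blk₂ T₁ K₁)
    (h₂ : BlockBd (g := toB6 g R H) blk₁ blk₂ T₂ K₂) :
    BlockBd (g := toB6 g R H) blk₁ blk₂ (T₁ + T₂) (fun a b => K₁ a b + K₂ a b) := by
  rw [blockBd_iff_hasMaj] at h₁ h₂ ⊢
  exact h₁.add h₂

/-- **THE TWO-SIDED L² LINE OF (3.46) FOR THE SUM G′(U) OF (3.90) AT ONE MEMBER AND ONE CONFIGURATION U** — the L² block bound of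
∇_UG′∇\*_U: G′ = G′₀ + G′R′ ((3.88), `fixedPoint_of_388`) read as ∇_UG′∇\*_U = ∇_UG′₀∇\*_U + (∇_UG′)(R′∇\*_U); the L² legs summed with N₂; the
sibling's L² block bound of ∇_UG′ from the pin's sup majorants and the transpose letter (`blockBd_entry1`); the L² bounds of the terms of
R′∇\*_U summed with N′; `tail_comp_l2`.  Bound: `twoConst d₁ δ₁ α₁ N₂ B₂ N′ θ₂ C L₀`·e^{−(1−2α)δd(y,y′)} provided 2αδ ≦ δ, (1 − 2α)δ ≦ (1 − α₁)δ₁.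
[cite: Balaban1985BackgroundPropagators, Thm 3.7 (3.87)–(3.90) pp.408–410 + (3.46) p.398 + p.391; Balaban1984PropagatorsII, (2.52)–(2.55) p.232 + Lemma 2.1 p.234] -/
theorem l2line4_of_local37 [Fintype X] [DecidableEq X] [Fintype Y] [DecidableEq Y] [Fintype ι]
    (𝔬 : Ops g B X Y ι) (R : ℝ) (H : Prop) (d d₁ : ℕ) (δ α L₀ δ₁ α₁ ρ N N' Cℓ N2 B2 θ2 C : ℝ) (κ : Sizes)
    (S2 : ι → Finset g.Site) (U : B.Cfg)
    (hN' : 0 ≤ N') (hN2 : 0 ≤ N2) (hB2 : 0 ≤ B2) (hθ2 : 0 ≤ θ2) (hC : 0 ≤ C)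
    (hα2 : 2 * α * δ ≤ δ) (hα₁δ₁ : 0 ≤ α₁ * δ₁) (hrate : (1 - 2 * α) * δ ≤ (1 - α₁) * δ₁)
    (hs : StaticOK 𝔬 ρ N N' Cℓ κ) (hcnt2 : ∀ a : g.Site, (∑ i, if a ∈ S2 i then (1 : ℝ) else 0) ≤ N2)
    (h261 : Ineq261 d₁ (toB6 g R H) δ₁ α₁) (hF : Facts347 g R H d δ α L₀) (hi : Identities 𝔬 R H U)
    (hL : L2TwoLegs37 𝔬 R H S2 B2 δ₁ U) (hFL : FactorsL2_37 𝔬 R H θ2 δ₁ U)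
    (h1 : HasMajorantHom (g := toB6 g R H) 𝔬.blk 𝔬.blkY (𝔬.D U ∘ₗ 𝔬.Gp U)
      (fun (a b : g.Site) => C * g.len a * Real.exp (-(δ * g.dist a b))))
    (h2 : HasMajorantHom (g := toB6 g R H) 𝔬.blkY 𝔬.blk (𝔬.Gp U ∘ₗ 𝔬.Dstar U)
      (fun (a b : g.Site) => C * g.len a * Real.exp (-(δ * g.dist a b))))
    (htr : IsTransposePair (𝔬.D U ∘ₗ 𝔬.Gp U) (𝔬.Gp U ∘ₗ 𝔬.Dstar U)) :
    BlockBd (g := toB6 g R H) 𝔬.blkY 𝔬.blkY (𝔬.D U ∘ₗ (𝔬.Gp U ∘ₗ 𝔬.Dstar U))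
      (fun (a b : g.Site) => twoConst d₁ δ₁ α₁ N2 B2 N' θ2 C L₀ * Real.exp (-((1 - 2 * α) * δ * g.dist a b))) := by
  have hlen0 : ∀ y : g.Site, 0 ≤ g.len y := fun y => (hs.lenpos y).le
  have htri : Triangle254 (toB6 g R H) := fun a b c => hs.tri a b c
  have hc1 : 0 ≤ B6.c1 d₁ δ₁ α₁ := c1_nonneg d₁ δ₁ α₁
  have hL₀ : 0 ≤ L₀ := le_trans (le_trans zero_le_one hF.one_le_L) hF.L_le
  have hρ'0 : 0 ≤ (1 - 2 * α) * δ := by nlinarith [hα2]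
  have hexp : ∀ a b : g.Site, Real.exp (-(δ₁ * g.dist a b)) ≤ Real.exp (-((1 - 2 * α) * δ * g.dist a b)) := fun a b =>
    Real.exp_le_exp.mpr (neg_le_neg (mul_le_mul_of_nonneg_right (by nlinarith [hrate, hα₁δ₁]) (hs.dnn a b)))
  have hfix : 𝔬.Gp U = (∑ i, mulOp (𝔬.h i) * 𝔬.Gsq U i * mulOp (𝔬.h i)) +
      𝔬.Gp U * ∑ i, (𝔬.P U i ∘ₗ 𝔬.D U + 𝔬.Cop U i) * 𝔬.Gsq U i * mulOp (𝔬.h i) :=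
    fixedPoint_of_388 hi.inv hi.eq388
  have hsumE : 𝔬.D U ∘ₗ ((∑ i, mulOp (𝔬.h i) * 𝔬.Gsq U i * mulOp (𝔬.h i)) ∘ₗ 𝔬.Dstar U) =
      ∑ i, 𝔬.D U ∘ₗ ((mulOp (𝔬.h i) * 𝔬.Gsq U i * mulOp (𝔬.h i)) ∘ₗ 𝔬.Dstar U) := by
    apply LinearMap.ext
    intro μ
    simp only [LinearMap.comp_apply, LinearMap.sum_apply, map_sum]
  have hsumF : (∑ i, (𝔬.P U i ∘ₗ 𝔬.D U + 𝔬.Cop U i) * 𝔬.Gsq U i * mulOp (𝔬.h i)) ∘ₗ 𝔬.Dstar U =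
      ∑ i, ((𝔬.P U i ∘ₗ 𝔬.D U + 𝔬.Cop U i) * 𝔬.Gsq U i * mulOp (𝔬.h i)) ∘ₗ 𝔬.Dstar U := by
    apply LinearMap.ext
    intro μ
    simp only [LinearMap.comp_apply, LinearMap.sum_apply]
  have hP : BlockBd (g := toB6 g R H) 𝔬.blkY 𝔬.blk
      ((∑ i, (𝔬.P U i ∘ₗ 𝔬.D U + 𝔬.Cop U i) * 𝔬.Gsq U i * mulOp (𝔬.h i)) ∘ₗ 𝔬.Dstar U)
      (fun (y y' : g.Site) => N' * θ2 * (g.len y)⁻¹ * Real.exp (-(δ₁ * g.dist y y'))) := by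
    rw [hsumF]
    have h := blockBd_localSum (R := R) (H := H) 𝔬.blkY 𝔬.blk
      (fun i => ((𝔬.P U i ∘ₗ 𝔬.D U + 𝔬.Cop U i) * 𝔬.Gsq U i * mulOp (𝔬.h i)) ∘ₗ 𝔬.Dstar U)
      (fun i (y : g.Site) => if y ∈ 𝔬.S' i then (1 : ℝ) else 0)
      (fun (y y' : g.Site) => θ2 * (g.len y)⁻¹ * Real.exp (-(δ₁ * g.dist y y'))) N'
      (fun y y' => mul_nonneg (mul_nonneg hθ2 (inv_nonneg.mpr (hlen0 y))) (Real.exp_nonneg _)) hFL.facD hs.cnt'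
    exact h.mono fun y y' => le_of_eq (by ring)
  have hS := blockBd_entry1 hF hC hs.symm hs.lenpos 𝔬.blk 𝔬.blkY h1 h2 htr
  have hρ : (1 - α) * δ = α * δ + (1 - 2 * α) * δ := by ring
  have htail := tail_comp_l2 (R := R) (H := H) 𝔬.blk 𝔬.blkY 𝔬.blkY hF h261 htri hs.symm hs.dnn hs.lenpos (mul_nonneg hC hL₀)
    (mul_nonneg hN' hθ2) hρ hρ'0 hrate hS hP
  have hhead := blockBd_localSum (R := R) (H := H) 𝔬.blkY 𝔬.blkY
    (fun i => 𝔬.D U ∘ₗ ((mulOp (𝔬.h i) * 𝔬.Gsq U i * mulOp (𝔬.h i)) ∘ₗ 𝔬.Dstar U))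
    (fun i (a : g.Site) => if a ∈ S2 i then (1 : ℝ) else 0) (fun (a b : g.Site) => B2 * Real.exp (-(δ₁ * g.dist a b))) N2
    (fun a b => mul_nonneg hB2 (Real.exp_nonneg _)) hL.l4 hcnt2
  rw [twoSided_split₃ hfix, hsumE]
  refine (blockBd_add' (R := R) (H := H) 𝔬.blkY 𝔬.blkY hhead htail).mono fun a b => ?_
  have hK0 : 0 ≤ N2 * B2 := mul_nonneg hN2 hB2
  calc N2 * (B2 * Real.exp (-(δ₁ * g.dist a b))) +
        C * L₀ * (N' * θ2) * L₀ * B6.c1 d₁ δ₁ α₁ * Real.exp (-((1 - 2 * α) * δ * g.dist a b))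
      = N2 * B2 * Real.exp (-(δ₁ * g.dist a b)) +
        C * L₀ * (N' * θ2) * L₀ * B6.c1 d₁ δ₁ α₁ * Real.exp (-((1 - 2 * α) * δ * g.dist a b)) := by ring
    _ ≤ N2 * B2 * Real.exp (-((1 - 2 * α) * δ * g.dist a b)) +
        C * L₀ * (N' * θ2) * L₀ * B6.c1 d₁ δ₁ α₁ * Real.exp (-((1 - 2 * α) * δ * g.dist a b)) :=
        add_le_add (mul_le_mul_of_nonneg_left (hexp a b) hK0) le_rfl
    _ = twoConst d₁ δ₁ α₁ N2 B2 N' θ2 C L₀ * Real.exp (-((1 - 2 * α) * δ * g.dist a b)) := by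
        unfold twoConst; ring

end GpSide

/-! ## §2 The complete leaf of Theorem 3.7: no displayed residual -/

section AllPinsGp

variable {I : Type} {c35 : ℝ} {geo : I → B9.Geometry} {bg : I → B9.Backgrounds}
variable [∀ i, Fintype (geo i).Site] [∀ i, DecidableEq (geo i).Site]

/-- ★ **THEOREM 3.7 AT THE ALL-BLOCKS PIN WITH NO DISPLAYED RESIDUAL** — p. 410: *"Theorem 3.7 implies that all the inequalities
(3.42)–(3.47) hold for G′, thus we have completed the proof of Theorem 3.1."*  The leaf `B9.Thm37Printed c35 geo bg (fun i => E37AllOfOps (𝔴 i)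
(𝔬 i) (R i) (H i) C δ (K i) B₀ δ₀ Bβ Bε Bεβ)` from n06-c's leaf at the sup-block pin `h37` and, per member and per regular configuration,
ONLY operator-level hypothesis schemas of printed shape (`Local342`, `Identities`, `HolderLegs37`, `HolderV37`, `LapLegs37`, `InputLegs37`,
`FactorsInput37`, `L2TwoLegs37`, `FactorsL2_37`), the static data and sizes (`StaticOK`, `Sizes.Bounded`), the readings, the letters, the member
facts and the family's constants — the sibling `B9RWSums344InputGp.thm37Printed_allPin_inputHolder` with its last displayed line SUPPLIED
by `l2line4_of_local37`.  Nothing of print asserted; NOT a node discharge.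
[cite: Balaban1985BackgroundPropagators, Thm 3.7 (3.87)–(3.90) pp.408–410 + Thm 3.1 (3.42)–(3.47) pp.397–398 + Cor. 3.6 p.408; Balaban1984PropagatorsII, Lemma 2.1 (2.60)–(2.61) p.234] -/
theorem thm37Printed_allPin_complete {X Y ι PX PY : I → Type} [∀ i, Fintype (X i)] [∀ i, DecidableEq (X i)]
    [∀ i, Fintype (Y i)] [∀ i, DecidableEq (Y i)] [∀ i, Fintype (ι i)] [∀ i, Fintype (PX i)] [∀ i, DecidableEq (PX i)]
    [∀ i, Fintype (PY i)] [∀ i, DecidableEq (PY i)]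
    {𝔴 : ∀ i, B9.RWExpansion (geo i) (bg i)} {𝔬 : ∀ i, Ops (geo i) (bg i) (X i) (Y i) (ι i)}
    {R : I → ℝ} {H : I → Prop} {C δ : ℝ}
    (𝔭 : ∀ i, HolderProbes (geo i) (bg i) (X i) (Y i) (PX i) (PY i))
    (bH : ∀ i, ℝ → BlockNorm (toB6 (geo i) (R i) (H i)) (Y i → ℝ))
    (K : ∀ i, B9.KernelFamily (geo i) (bg i)) (ev : ∀ i, (geo i).Loc → X i → ℝ) (evY : ∀ i, (geo i).Loc → Y i → ℝ)
    {d : ℕ} {α L₀ B₀ δ₀ Mg : ℝ} {Bβ Bε : ℝ → ℝ} {Bεβ : ℝ → ℝ → ℝ}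
    (κ : I → Sizes) (SH : ∀ i, ι i → Finset (geo i).Site) (Bl BV : ℝ → ℝ) (d₁ : ℕ)
    (δ₁ α₁ ρ N N' Cℓ Kc θ₀ B₁ NH a₁ M₁ ML : ℝ)
    (SL : ∀ i, ι i → Finset (geo i).Site) (NL BL MF : ℝ) (d₁' : ℕ)
    (SI : ∀ i, ι i → Finset (geo i).Site) (NI : ℝ) (BI θI : ℝ → ℝ) (BI2 : ℝ → ℝ → ℝ)
    (S2 : ∀ i, ι i → Finset (geo i).Site) (N2 B2 θ2 : ℝ)
    (h37 : B9.Thm37Printed c35 geo bg (fun i => E37OfOps (𝔴 i) (𝔬 i) (R i) (H i) C δ))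
    (hco0 : ∀ i U, CoRealizes (K i) 0 U (𝔬 i).blk (𝔬 i).blk (ev i) ((𝔬 i).Gp U))
    (hco1 : ∀ i U, CoRealizes (K i) 1 U (𝔬 i).blkY (𝔬 i).blk (ev i) ((𝔬 i).D U ∘ₗ (𝔬 i).Gp U))
    (hco2 : ∀ i U, CoRealizes (K i) 2 U (𝔬 i).blk (𝔬 i).blkY (evY i) ((𝔬 i).Gp U ∘ₗ (𝔬 i).Dstar U))
    (hco3 : ∀ i U, CoRealizes (K i) 3 U (𝔬 i).blk (𝔬 i).blk (ev i) ((𝔬 i).Lap U ∘ₗ (𝔬 i).Gp U))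
    (hgl0 : ∀ i U, GlobReads (K i) 0 U (𝔬 i).blk (𝔬 i).blk (ev i) ((𝔬 i).Gp U))
    (hgl1 : ∀ i U, GlobReads (K i) 1 U (𝔬 i).blkY (𝔬 i).blk (ev i) ((𝔬 i).D U ∘ₗ (𝔬 i).Gp U))
    (hgl2 : ∀ i U, GlobReads (K i) 2 U (𝔬 i).blk (𝔬 i).blkY (evY i) ((𝔬 i).Gp U ∘ₗ (𝔬 i).Dstar U))
    (hgl3 : ∀ i U, GlobReads (K i) 3 U (𝔬 i).blk (𝔬 i).blk (ev i) ((𝔬 i).Lap U ∘ₗ (𝔬 i).Gp U))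
    (hl0 : ∀ i U, L2Reads (R := R i) (H := H i) (K i) 0 U (𝔬 i).blk (𝔬 i).blk (ev i) ((𝔬 i).Gp U))
    (hl1 : ∀ i U, L2Reads (R := R i) (H := H i) (K i) 1 U (𝔬 i).blkY (𝔬 i).blk (ev i) ((𝔬 i).D U ∘ₗ (𝔬 i).Gp U))
    (hl2 : ∀ i U, L2Reads (R := R i) (H := H i) (K i) 2 U (𝔬 i).blk (𝔬 i).blkY (evY i) ((𝔬 i).Gp U ∘ₗ (𝔬 i).Dstar U))
    (hl3 : ∀ i U, L2Reads (R := R i) (H := H i) (K i) 3 U (𝔬 i).blk (𝔬 i).blk (ev i) ((𝔬 i).Lap U ∘ₗ (𝔬 i).Gp U))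
    (hl4 : ∀ i U, L2Reads (R := R i) (H := H i) (K i) 4 U (𝔬 i).blkY (𝔬 i).blkY (evY i)
      ((𝔬 i).D U ∘ₗ ((𝔬 i).Gp U ∘ₗ (𝔬 i).Dstar U)))
    (hl5 : ∀ i U, L2Reads (R := R i) (H := H i) (K i) 5 U (𝔬 i).blk (𝔬 i).blk (ev i) ((𝔬 i).Gp U ∘ₗ (𝔬 i).Lap U))
    (hH1 : ∀ i U, H1Reads (K i) U (𝔭 i) (𝔬 i).blk (𝔬 i).blkY (ev i) (evY i) ((𝔬 i).D U ∘ₗ (𝔬 i).Gp U)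
      ((𝔬 i).Gp U ∘ₗ (𝔬 i).Dstar U))
    (hIR : ∀ i U, InputReads (K i) U (𝔭 i) (bH i) (𝔬 i).blkY (evY i) ((𝔬 i).D U ∘ₗ ((𝔬 i).Gp U ∘ₗ (𝔬 i).Dstar U)))
    (hsym : ∀ i U, IsTransposePair ((𝔬 i).Gp U) ((𝔬 i).Gp U))
    (htr : ∀ i U, IsTransposePair ((𝔬 i).D U ∘ₗ (𝔬 i).Gp U) ((𝔬 i).Gp U ∘ₗ (𝔬 i).Dstar U))
    (hadjL : ∀ i U, IsTransposePair ((𝔬 i).Lap U ∘ₗ (𝔬 i).Gp U) ((𝔬 i).Gp U ∘ₗ (𝔬 i).Lap U))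
    (hfacts : ∀ i, Mg ≤ (geo i).M → Facts347 (geo i) (R i) (H i) d δ α L₀)
    (hdsymm : ∀ i (a b : (geo i).Site), (geo i).dist a b = (geo i).dist b a)
    (hC : 0 ≤ C) (hCB : C ≤ B₀) (hCL : C * L₀ ≤ B₀) (hδ₀ : δ₀ ≤ (1 - α) * δ) (hδ₀2 : δ₀ ≤ (1 - 2 * α) * δ) (hα : 0 ≤ α * δ)
    (hα2 : 2 * α * δ ≤ δ) (hCg : C * B6.c1 d δ (1 - α) * L₀ ^ (4 : ℝ) ≤ B₀)
    (hc : 0 < c35) (ha₁ : 0 < a₁) (hα₁ : 0 ≤ α₁) (hα₁2 : α₁ ≤ 1 / 2) (hN' : 0 ≤ N') (hCℓ : 0 ≤ Cℓ)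
    (hB₁ : 0 ≤ B₁) (hNH : 0 ≤ NH) (hM₁ : 0 < M₁) (hδnn : 0 ≤ δ) (hδ5 : δ ≤ (1 - 2 * α₁) * δ₁) (hδ₁ : 0 ≤ δ₁) (hNL : 0 ≤ NL)
    (hBL : 0 ≤ BL) (hNI : 0 ≤ NI) (hN2 : 0 ≤ N2) (hB2 : 0 ≤ B2) (hθ2 : 0 ≤ θ2)
    (hB5 : Real.sqrt (C * lapConst d₁ δ₁ α₁ NL BL L₀) * L₀ ≤ B₀) (hB4 : twoConst d₁ δ₁ α₁ N2 B2 N' θ2 C L₀ ≤ B₀)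
    (hst : ∀ i, StaticOK (𝔬 i) ρ N N' Cℓ (κ i)) (hκ : ∀ i, (κ i).Bounded Kc θ₀ Cℓ (geo i).M)
    (hcntH : ∀ i (a : (geo i).Site), (∑ q, if a ∈ SH i q then (1 : ℝ) else 0) ≤ NH)
    (hcntL : ∀ i (a : (geo i).Site), (∑ q, if a ∈ SL i q then (1 : ℝ) else 0) ≤ NL)
    (hcntI : ∀ i (a : (geo i).Site), (∑ q, if a ∈ SI i q then (1 : ℝ) else 0) ≤ NI)
    (hcnt2 : ∀ i (a : (geo i).Site), (∑ q, if a ∈ S2 i q then (1 : ℝ) else 0) ≤ N2)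
    (hBl : ∀ β, 0 ≤ β → β < 1 → 0 ≤ Bl β) (hBV : ∀ β, 0 ≤ β → β < 1 → 0 ≤ BV β)
    (hBI : ∀ ε, 0 < ε → ε ≤ 1 → 0 ≤ BI ε) (hBI2 : ∀ ε β, 0 < ε → ε ≤ 1 → 0 ≤ β → β < 1 → 0 ≤ BI2 ε β)
    (hθI : ∀ ε, 0 < ε → 0 ≤ θI ε)
    (hBβ : ∀ β, 0 ≤ β → β < 1 → holderConst d₁ δ₁ α₁ NH N' C (Bl β) (BV β) ≤ Bβ β)
    (hBε : ∀ ε, 0 < ε → ε ≤ 1 → inputConst44 d₁ δ₁ α₁ NI N' C L₀ (BI ε) (θI ε) ≤ Bε ε)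
    (hBεβ : ∀ ε β, 0 < ε → ε ≤ 1 → 0 ≤ β → β < 1 →
      inputConst45 d₁ δ₁ α₁ NI N' L₀ (holderConst d₁ δ₁ α₁ NH N' C (Bl β) (BV β)) (BI2 ε β) (θI (β + ε)) ≤ Bεβ ε β)
    (h261 : ∀ i, ML ≤ (geo i).M → Ineq261 d₁ (toB6 (geo i) (R i) (H i)) δ₁ α₁)
    (hF₁ : ∀ i, MF ≤ (geo i).M → Facts347 (geo i) (R i) (H i) d₁' δ₁ α₁ L₀)
    (hop : ∀ i, M₁ ≤ (geo i).M → ∀ α₀ : ℝ, 0 < α₀ → c35 * (geo i).M * α₀ ≤ a₁ →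
      ∀ U : (bg i).Cfg, (bg i).Reg335 c35 α₀ U →
        Local342 (𝔬 i) (R i) (H i) B₁ δ₁ U ∧ Identities (𝔬 i) (R i) (H i) U ∧
          HolderLegs37 (𝔬 i) (𝔭 i) (R i) (H i) (SH i) Bl δ₁ U ∧ HolderV37 (𝔬 i) (𝔭 i) (R i) (H i) BV δ₁ U)
    (hopL : ∀ i, M₁ ≤ (geo i).M → ∀ α₀ : ℝ, 0 < α₀ → c35 * (geo i).M * α₀ ≤ a₁ →
      ∀ U : (bg i).Cfg, (bg i).Reg335 c35 α₀ U → LapLegs37 (𝔬 i) (R i) (H i) (SL i) BL δ₁ U)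
    (hopI : ∀ i, M₁ ≤ (geo i).M → ∀ α₀ : ℝ, 0 < α₀ → c35 * (geo i).M * α₀ ≤ a₁ →
      ∀ U : (bg i).Cfg, (bg i).Reg335 c35 α₀ U →
        InputLegs37 (𝔬 i) (𝔭 i) (R i) (H i) (bH i) (SI i) BI BI2 δ₁ U ∧ FactorsInput37 (𝔬 i) (R i) (H i) (bH i) θI δ₁ U)
    (hop2 : ∀ i, M₁ ≤ (geo i).M → ∀ α₀ : ℝ, 0 < α₀ → c35 * (geo i).M * α₀ ≤ a₁ →
      ∀ U : (bg i).Cfg, (bg i).Reg335 c35 α₀ U →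
        L2TwoLegs37 (𝔬 i) (R i) (H i) (S2 i) B2 δ₁ U ∧ FactorsL2_37 (𝔬 i) (R i) (H i) θ2 δ₁ U) :
    B9.Thm37Printed c35 geo bg (fun i => E37AllOfOps (𝔴 i) (𝔬 i) (R i) (H i) C δ (K i) B₀ δ₀ Bβ Bε Bεβ) := by
  have hαδ₁ : 0 ≤ α₁ * δ₁ := mul_nonneg hα₁ hδ₁
  have hrate : (1 - 2 * α) * δ ≤ (1 - α₁) * δ₁ := by nlinarith [hα, hδ5, hαδ₁]
  have h37' := h37
  obtain ⟨M₂, a₀, hM₂, ha₀, hE⟩ := h37'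
  have hB₀ : 0 ≤ B₀ := hC.trans hCB
  refine thm37Printed_allPin_inputHolder (Mr := max M₂ (max M₁ (max ML Mg))) (ar := min a₀ (a₁ / c35)) 𝔭 bH K ev evY κ SH Bl BV d₁
    δ₁ α₁ ρ N N' Cℓ Kc θ₀ B₁ NH a₁ M₁ ML SL NL BL MF d₁' SI NI BI θI BI2 h37 hco0 hco1 hco2 hco3 hgl0 hgl1 hgl2 hgl3 hl0 hl1 hl2 hl3
    hl5 hH1 hIR hsym htr hadjL hfacts hdsymm hC hCB hCL hδ₀ hα (by linarith) hCg (lt_min ha₀ (div_pos ha₁ hc)) hc ha₁ hα₁ hα₁2 hN'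
    hCℓ hB₁ hNH hM₁ hδnn hδ5 hδ₁ hNL hBL hNI hB5 hst hκ hcntH hcntL hcntI hBl hBV hBI hBI2 hθI hBβ hBε hBεβ h261 hF₁ hop hopL hopI
    fun i hM α₀ hα₀ hMa U hU lam h y y' hcut hsupp => ?_
  have hM₂i : M₂ ≤ (geo i).M := le_trans (le_max_left _ _) hM
  have hM₁i : M₁ ≤ (geo i).M := le_trans (le_trans (le_max_left _ _) (le_max_right _ _)) hM
  have hMLi : ML ≤ (geo i).M := le_trans (le_trans (le_trans (le_max_left _ _) (le_max_right _ _)) (le_max_right _ _)) hM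
  have hMg : Mg ≤ (geo i).M := le_trans (le_trans (le_trans (le_max_right _ _) (le_max_right _ _)) (le_max_right _ _)) hM
  have hMa₀ : (geo i).M * α₀ ≤ a₀ := hMa.trans (min_le_left _ _)
  have ha : c35 * (geo i).M * α₀ ≤ a₁ := by
    have h1 : (geo i).M * α₀ * c35 ≤ a₁ := (le_div_iff₀ hc).mp (hMa.trans (min_le_right _ _))
    calc c35 * (geo i).M * α₀ = (geo i).M * α₀ * c35 := by ring
      _ ≤ a₁ := h1
  have hconv : Conv342 (𝔬 i) (R i) (H i) C δ U := hE i hM₂i α₀ hα₀ hMa₀ U hU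
  obtain ⟨-, h1, h2, -⟩ := hconv
  obtain ⟨-, hi, -, -⟩ := hop i hM₁i α₀ hα₀ ha U hU
  obtain ⟨hL2, hFL⟩ := hop2 i hM₁i α₀ hα₀ ha U hU
  have hlen0 : ∀ z : (geo i).Site, 0 ≤ (geo i).len z := fun z => ((hst i).lenpos z).le
  have hblk := l2line4_of_local37 (𝔬 i) (R i) (H i) d d₁ δ α L₀ δ₁ α₁ ρ N N' Cℓ N2 B2 θ2 C (κ i) (S2 i) U hN' hN2 hB2 hθ2 hC hα2
    hαδ₁ hrate (hst i) (hcnt2 i) (h261 i hMLi) (hfacts i hMg) hi hL2 hFL h1 h2 (htr i U)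
  have hblk' : BlockBd (g := toB6 (geo i) (R i) (H i)) (𝔬 i).blkY (𝔬 i).blkY ((𝔬 i).D U ∘ₗ ((𝔬 i).Gp U ∘ₗ (𝔬 i).Dstar U))
      (fun (a b : (geo i).Site) => B₀ * B9.pref6 ((geo i).len a) 4 * Real.exp (-(δ₀ * (geo i).dist a b))) := by
    refine hblk.mono fun a b => ?_
    rw [pref6_four, mul_one]
    exact mul_le_mul hB4 (Real.exp_le_exp.mpr (neg_le_neg (mul_le_mul_of_nonneg_right hδ₀2 ((hst i).dnn a b))))
      (Real.exp_nonneg _) hB₀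
  exact l2line_of_blockBd (hl4 i U) hB₀ hlen0 hblk' lam h y y' hcut hsupp

end AllPinsGp

end

end Literature.MathematicalPhysics.QuantumFieldTheory.Balaban1983to89.B9RWSums346TwoGp
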